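import Summits.Ventures.CertifiedManyBodySolver.Downfold.EmeryFillingParametric
import Summits.Ventures.CertifiedManyBodySolver.Downfold.EmeryFermiEnergyOf
import HarnessLib

/-!
# THE FERMI ENERGY IS A CONTINUOUS FUNCTION OF THE ROW: stability of every solution of `abFilling θ ε = ν` under perturbation of
# `θ = (Δ, t_pd, t_pp, t_pp′)`, local existence, and continuity of `fermiEnergyOf` within the physical region

Venture CertifiedManyBodySolver, cell `pub/hubbard-downfold` (stage S1; INFLATION-RULES-3to1-B §B.83 (d)–(e)), seat hubbard-downfold-mod-4
(technique B, g34); namespace `Summit.Ventures.CertifiedManyBodySolver.Downfold.Emery`. Everything PROVED (0 sorry, no definition). WHAT THIS IS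
NOT: a statement about any material; `U = 0` one-body kinematics of the σ (d–p_x–p_y + t_pp, t_pp′) model; no number lives here.

Sequel of `EmeryFillingParametric` (joint continuity of the filling in (row, energy)) and `EmeryFermiEnergyOf` (the Fermi energy as a term):

* §1 `abFilling_zero'`, `pos_of_abFilling_eq`: at `Δ > 0`, `t_pd ≠ 0`, `t_pp, t_pp′ ≥ 0` the band bottom carries no filling, so an energy of
  filling `ν > 0` is POSITIVE.
* §2 **STABILITY** (`fermiEnergy_stable`): if `abFilling θ₀ ε₀ = ν` with `0 < ν < 1`, then for every `η > 0`, for all rows `θ` near `θ₀`, EVERY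
  solution of `abFilling θ ε = ν` lies in `(ε₀ − η, ε₀ + η)` (strict monotonicity at `θ₀` + continuity in the row at the two energies `ε₀ ± η`);
  **LOCAL EXISTENCE** (`exists_fermiEnergy_nhds`): for all rows near `θ₀` a solution EXISTS in that window (continuity in the energy at the
  perturbed row, `continuousAt_abFilling_of_pos`, and the intermediate value theorem).
* §3 **`fermiEnergyOf` IS CONTINUOUS IN THE ROW within the physical region** `{Δ > 0, t_pd ≠ 0, t_pp ≥ 0, t_pp′ ≥ 0}`
  (`continuousWithinAt_fermiEnergyOf_param`): the [float] → ℚ transcription of a typed row moves its Fermi energy — and every continuous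
  reading at it — continuously; interval (box) statements about `ε_F` are limits of point statements.

Sources: three-band model [HybertsenSchluterChristensen1989, Eq. (1)]; [AndersenEtAl1995, §6]; elementary topology [folklore].
-/

noncomputable section

namespace Summit.Ventures.CertifiedManyBodySolver.Downfold.Emery

open Real MeasureTheory Set Filter Topology

/-! ## §1–§2 Positivity of the Fermi energy; stability and local existence -/

section Stable

variable {Δ a b c : ℝ}

/-- `abFilling(0) = 0` for `Δ > 0`, `t_pd ≠ 0`, `t_pp, t_pp′ ≥ 0`: the occupied set at the band bottom is `{Γ}`. [folklore] -/
theorem abFilling_zero' (hΔ : 0 < Δ) (ha : a ≠ 0) (hc : 0 ≤ c) (hb : 0 ≤ b) : abFilling Δ a b c 0 = 0 := by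
  have hsub : abOccSet Δ a b c 0 ⊆ {((0 : ℝ), (0 : ℝ))} := by
    rw [abOccSet_eq]
    rintro ⟨k₁, k₂⟩ ⟨⟨⟨h1l, h1r⟩, ⟨h2l, h2r⟩⟩, hle⟩
    have hle' : abEnergyK Δ a b c (k₁, k₂) ≤ 0 := hle
    have hxy : halfSq k₁ + halfSq k₂ = 0 := by
      by_contra hne
      have hpos : 0 < halfSq k₁ + halfSq k₂ := lt_of_le_of_ne (add_nonneg (halfSq_nonneg _) (halfSq_nonneg _)) (Ne.symm hne)
      have := abBand_pos_of_sum_pos hΔ ha hc hb (halfSq_nonneg k₁) (halfSq_nonneg k₂) hpos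
      unfold abEnergyK at hle'; simp only at hle'; linarith
    have hx : halfSq k₁ = 0 := by linarith [halfSq_nonneg k₁, halfSq_nonneg k₂]
    have hy : halfSq k₂ = 0 := by linarith [halfSq_nonneg k₁, halfSq_nonneg k₂]
    have h0 : halfSq 0 = 0 := by unfold halfSq; simp
    have e1 : k₁ = 0 := halfSq_injOn ⟨h1l, h1r⟩ ⟨le_rfl, pi_pos.le⟩ (by rw [hx, h0])
    have e2 : k₂ = 0 := halfSq_injOn ⟨h2l, h2r⟩ ⟨le_rfl, pi_pos.le⟩ (by rw [hy, h0])
    rw [e1, e2]; rfl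
  unfold abFilling
  rw [measure_mono_null hsub (measure_singleton _), ENNReal.toReal_zero, zero_div]

/-- An energy of filling `ν ∈ (0, 1)` is POSITIVE (`Δ > 0`, `t_pd ≠ 0`, `t_pp, t_pp′ ≥ 0`). [folklore] -/
theorem pos_of_abFilling_eq (hΔ : 0 < Δ) (ha : a ≠ 0) (hc : 0 ≤ c) (hb : 0 ≤ b) {ν ε : ℝ} (hν0 : 0 < ν)
    (h : abFilling Δ a b c ε = ν) : 0 < ε := by
  have hε0 : 0 ≤ ε := nonneg_of_abFilling_pos (a := a) hΔ.le hc hb (by rw [h]; exact hν0)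
  rcases hε0.lt_or_eq with hlt | heq
  · exact hlt
  · exfalso
    rw [← heq, abFilling_zero' hΔ ha hc hb] at h
    linarith

/-- **THE FERMI ENERGY IS STABLE UNDER PERTURBATION OF THE ROW**: if `abFilling θ₀ ε₀ = ν` with `0 < ν < 1` (`Δ₀ > 0`, `t_pd,0 ≠ 0`,
`t_pp,0, t_pp′,0 ≥ 0`), then for every `η > 0`, for all parameter quadruples `θ` near `θ₀`, EVERY solution `ε` of `abFilling θ ε = ν`
satisfies `|ε − ε₀| < η`. [folklore] -/
theorem fermiEnergy_stable {θ₀ : ℝ × ℝ × ℝ × ℝ} (hΔ : 0 < θ₀.1) (ha : θ₀.2.1 ≠ 0) (hb : 0 ≤ θ₀.2.2.1) (hc : 0 ≤ θ₀.2.2.2)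
    {ν ε₀ : ℝ} (hν0 : 0 < ν) (hν1 : ν < 1) (h₀ : abFilling θ₀.1 θ₀.2.1 θ₀.2.2.1 θ₀.2.2.2 ε₀ = ν) {η : ℝ} (hη : 0 < η) :
    ∀ᶠ θ : ℝ × ℝ × ℝ × ℝ in 𝓝 θ₀, ∀ ε : ℝ, abFilling θ.1 θ.2.1 θ.2.2.1 θ.2.2.2 ε = ν → |ε - ε₀| < η := by
  have hε₀ : 0 < ε₀ := pos_of_abFilling_eq hΔ ha hc hb hν0 h₀
  obtain ⟨ks, hks, hksE⟩ := exists_gt_of_abFilling_lt_one (Δ := θ₀.1) (a := θ₀.2.1) (b := θ₀.2.2.1) (c := θ₀.2.2.2) (ε := ε₀)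
    (by rw [h₀]; exact hν1)
  set η' : ℝ := min η (min (ε₀ / 2) (abEnergyK θ₀.1 θ₀.2.1 θ₀.2.2.1 θ₀.2.2.2 ks - ε₀)) with hη'
  have hη'pos : 0 < η' := lt_min hη (lt_min (by linarith) (by linarith))
  have hη'le : η' ≤ η := min_le_left _ _
  have hη'ε : η' ≤ ε₀ / 2 := (min_le_right _ _).trans (min_le_left _ _)
  have hη'E : η' ≤ abEnergyK θ₀.1 θ₀.2.1 θ₀.2.2.1 θ₀.2.2.2 ks - ε₀ := (min_le_right _ _).trans (min_le_right _ _)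
  have hlo : abFilling θ₀.1 θ₀.2.1 θ₀.2.2.1 θ₀.2.2.2 (ε₀ - η') < ν := by
    rw [← h₀]
    exact abFilling_lt_abFilling hΔ.le hc hb (by linarith) (by linarith) hks hksE.le
  have hhi : ν < abFilling θ₀.1 θ₀.2.1 θ₀.2.2.1 θ₀.2.2.2 (ε₀ + η') := by
    rw [← h₀]
    exact abFilling_lt_abFilling hΔ.le hc hb hε₀.le (by linarith) hks (by linarith)
  have hc₁ := continuousAt_abFilling_param_fixed hΔ ha hb hc (show 0 < ε₀ - η' by linarith)
  have hc₂ := continuousAt_abFilling_param_fixed hΔ ha hb hc (show 0 < ε₀ + η' by linarith)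
  have hev₁ := hc₁.eventually_lt continuousAt_const hlo
  have hev₂ := continuousAt_const.eventually_lt hc₂ hhi
  filter_upwards [hev₁, hev₂] with θ h₁ h₂ ε hε
  have h₁' : abFilling θ.1 θ.2.1 θ.2.2.1 θ.2.2.2 (ε₀ - η') < ν := h₁
  have h₂' : ν < abFilling θ.1 θ.2.1 θ.2.2.1 θ.2.2.2 (ε₀ + η') := h₂
  have hgt : ε₀ - η' < ε := by
    by_contra hle; push Not at hle
    have := abFilling_mono θ.1 θ.2.1 θ.2.2.1 θ.2.2.2 hle
    linarith
  have hlt : ε < ε₀ + η' := by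
    by_contra hge; push Not at hge
    have := abFilling_mono θ.1 θ.2.1 θ.2.2.1 θ.2.2.2 hge
    linarith
  rw [abs_lt]; constructor <;> linarith

/-- **LOCAL EXISTENCE**: under the hypotheses of `fermiEnergy_stable`, for all rows `θ` near `θ₀` there IS a solution of
`abFilling θ ε = ν` with `|ε − ε₀| < η`. [folklore] -/
theorem exists_fermiEnergy_nhds {θ₀ : ℝ × ℝ × ℝ × ℝ} (hΔ : 0 < θ₀.1) (ha : θ₀.2.1 ≠ 0) (hb : 0 ≤ θ₀.2.2.1) (hc : 0 ≤ θ₀.2.2.2)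
    {ν ε₀ : ℝ} (hν0 : 0 < ν) (hν1 : ν < 1) (h₀ : abFilling θ₀.1 θ₀.2.1 θ₀.2.2.1 θ₀.2.2.2 ε₀ = ν) {η : ℝ} (hη : 0 < η) :
    ∀ᶠ θ : ℝ × ℝ × ℝ × ℝ in 𝓝 θ₀, ∃ ε : ℝ, |ε - ε₀| < η ∧ abFilling θ.1 θ.2.1 θ.2.2.1 θ.2.2.2 ε = ν := by
  have hε₀ : 0 < ε₀ := pos_of_abFilling_eq hΔ ha hc hb hν0 h₀
  obtain ⟨ks, hks, hksE⟩ := exists_gt_of_abFilling_lt_one (Δ := θ₀.1) (a := θ₀.2.1) (b := θ₀.2.2.1) (c := θ₀.2.2.2) (ε := ε₀)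
    (by rw [h₀]; exact hν1)
  set η' : ℝ := min η (min (ε₀ / 2) (abEnergyK θ₀.1 θ₀.2.1 θ₀.2.2.1 θ₀.2.2.2 ks - ε₀)) with hη'
  have hη'pos : 0 < η' := lt_min hη (lt_min (by linarith) (by linarith))
  have hη'le : η' ≤ η := min_le_left _ _
  have hη'ε : η' ≤ ε₀ / 2 := (min_le_right _ _).trans (min_le_left _ _)
  have hη'E : η' ≤ abEnergyK θ₀.1 θ₀.2.1 θ₀.2.2.1 θ₀.2.2.2 ks - ε₀ := (min_le_right _ _).trans (min_le_right _ _)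
  have hlo : abFilling θ₀.1 θ₀.2.1 θ₀.2.2.1 θ₀.2.2.2 (ε₀ - η') < ν := by
    rw [← h₀]; exact abFilling_lt_abFilling hΔ.le hc hb (by linarith) (by linarith) hks hksE.le
  have hhi : ν < abFilling θ₀.1 θ₀.2.1 θ₀.2.2.1 θ₀.2.2.2 (ε₀ + η') := by
    rw [← h₀]; exact abFilling_lt_abFilling hΔ.le hc hb hε₀.le (by linarith) hks (by linarith)
  have hc₁ := continuousAt_abFilling_param_fixed hΔ ha hb hc (show 0 < ε₀ - η' by linarith)
  have hc₂ := continuousAt_abFilling_param_fixed hΔ ha hb hc (show 0 < ε₀ + η' by linarith)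
  have hev₁ := hc₁.eventually_lt continuousAt_const hlo
  have hev₂ := continuousAt_const.eventually_lt hc₂ hhi
  -- Δ > 0 persists near θ₀ (for the continuity in the energy at the perturbed row)
  have hevΔ : ∀ᶠ θ : ℝ × ℝ × ℝ × ℝ in 𝓝 θ₀, 0 < θ.1 := continuousAt_const.eventually_lt continuousAt_fst hΔ
  filter_upwards [hev₁, hev₂, hevΔ] with θ h₁ h₂ hΔθ
  have h₁' : abFilling θ.1 θ.2.1 θ.2.2.1 θ.2.2.2 (ε₀ - η') < ν := h₁
  have h₂' : ν < abFilling θ.1 θ.2.1 θ.2.2.1 θ.2.2.2 (ε₀ + η') := h₂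
  have hcont : ContinuousOn (abFilling θ.1 θ.2.1 θ.2.2.1 θ.2.2.2) (Icc (ε₀ - η') (ε₀ + η')) := fun e he =>
    (continuousAt_abFilling_of_pos hΔθ.le (by linarith [he.1])).continuousWithinAt
  obtain ⟨ε, hε, hfε⟩ := intermediate_value_Icc (by linarith : ε₀ - η' ≤ ε₀ + η') hcont ⟨h₁'.le, h₂'.le⟩
  refine ⟨ε, ?_, hfε⟩
  -- the solution is strictly inside the window (the endpoints miss ν), so within η' ≤ η of ε₀
  have hne1 : ε ≠ ε₀ - η' := fun h => by rw [h] at hfε; linarith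
  have hne2 : ε ≠ ε₀ + η' := fun h => by rw [h] at hfε; linarith
  have hl : ε₀ - η' < ε := lt_of_le_of_ne hε.1 (Ne.symm hne1)
  have hr : ε < ε₀ + η' := lt_of_le_of_ne hε.2 hne2
  rw [abs_lt]; constructor <;> linarith

/-! ## §3 Continuity of `fermiEnergyOf` in the row -/

/-- **THE FERMI ENERGY IS A CONTINUOUS FUNCTION OF THE ROW** within the physical region `{Δ > 0, t_pd ≠ 0, t_pp ≥ 0, t_pp′ ≥ 0}`: at a row
`θ₀` of the region where the filling `ν ∈ (0, 1)` is attained, `θ ↦ fermiEnergyOf θ ν` is continuous at `θ₀` along the region. [folklore] -/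
theorem continuousWithinAt_fermiEnergyOf_param {θ₀ : ℝ × ℝ × ℝ × ℝ} (hΔ : 0 < θ₀.1) (ha : θ₀.2.1 ≠ 0) (hb : 0 ≤ θ₀.2.2.1)
    (hc : 0 ≤ θ₀.2.2.2) {ν : ℝ} (hν0 : 0 < ν) (hν1 : ν < 1) (hex : ∃ ε : ℝ, abFilling θ₀.1 θ₀.2.1 θ₀.2.2.1 θ₀.2.2.2 ε = ν) :
    ContinuousWithinAt (fun θ : ℝ × ℝ × ℝ × ℝ => fermiEnergyOf θ.1 θ.2.1 θ.2.2.1 θ.2.2.2 ν)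
      {θ : ℝ × ℝ × ℝ × ℝ | 0 < θ.1 ∧ θ.2.1 ≠ 0 ∧ 0 ≤ θ.2.2.1 ∧ 0 ≤ θ.2.2.2} θ₀ := by
  set ε₀ := fermiEnergyOf θ₀.1 θ₀.2.1 θ₀.2.2.1 θ₀.2.2.2 ν with hε₀
  have h₀ : abFilling θ₀.1 θ₀.2.1 θ₀.2.2.1 θ₀.2.2.2 ε₀ = ν := abFilling_fermiEnergyOf hΔ.le hc hb hν0 hν1 hex
  rw [ContinuousWithinAt, Metric.tendsto_nhds]
  intro η hη
  have hst := fermiEnergy_stable hΔ ha hb hc hν0 hν1 h₀ hη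
  have hexn := exists_fermiEnergy_nhds hΔ ha hb hc hν0 hν1 h₀ hη
  have hboth := (hst.and hexn).filter_mono (nhdsWithin_le_nhds (s := {θ : ℝ × ℝ × ℝ × ℝ | 0 < θ.1 ∧ θ.2.1 ≠ 0 ∧ 0 ≤ θ.2.2.1 ∧ 0 ≤ θ.2.2.2}))
  filter_upwards [hboth, self_mem_nhdsWithin] with θ hθ hreg
  obtain ⟨hstab, ⟨ε, -, hfε⟩⟩ := hθ
  obtain ⟨hΔθ, -, hbθ, hcθ⟩ := hreg
  have heq : fermiEnergyOf θ.1 θ.2.1 θ.2.2.1 θ.2.2.2 ν = ε := fermiEnergyOf_eq_of_abFilling_eq hΔθ.le hcθ hbθ hν0 hν1 hfε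
  rw [Real.dist_eq, heq]
  exact hstab ε hfε

end Stable

end Summit.Ventures.CertifiedManyBodySolver.Downfold.Emery
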